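import Summits.Ventures.YMGap.RobustBall.TrailLoopFamily
import Summits.Ventures.YMGap.RobustBall.RectangleLoopFamily
import Summits.Ventures.YMGap.RobustBall.RowsSDim3
import HarnessLib

/-!
# Venture YMGap, track ROBUST-BALL (tier 2) — the concrete loop families on `ℤ³` (all closed trails, all rectangles)

HONEST FRAMING. WHAT THIS IS: a venture file (cell `pub-ymgap`, track Y2 ROBUST-BALL, seat rb-p1): the `d = 3` readings of
the loop-family members (`TrailLoopFamily.lean`, `RectangleLoopFamily.lean`, both dimension-generic) on the `ℤ³` tier-2 cells
of `RowsSDim3.lean` — the three-dimensional lattice being the one the cell's `YM₃` lane (Y4) consumes. `SU(2)` on `ℤ³` at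
`β_W = 1/16`: EVERY coupling function on ALL nontrivial closed trails with `‖c‖_{log 2} ≤ 0.219` (`su2_dim3_allTrails_massGapS_1_16`),
and EVERY rectangle-coupling family with `|c_{x,ab,R,T}| ≤ ½·32^{-(R+T)}` (`su2_dim3_rectFamily_massGapS_1_16`, hypothesis-free) give
a unique DLR state with exponential clustering; every `SU(N)`, `N ≥ 2`, at 't Hooft `|β| ≤ 1/64`: `‖c‖_{log(6/5)} ≤ 0.19` on all
closed trails (`suN_dim3_allTrails_massGapS_1_64`) and `|c_i| ≤ 32^{-(R+T)}` on all rectangles (`suN_dim3_rectFamily_massGapS_1_64`).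
WHAT IT IS NOT: strong-coupling lattice statements inside the rows' windows; nothing about the continuum limit or the Clay
problem.

References: this track's `RowsSDim3.lean`, `TrailLoopFamily.lean`, `RectangleLoopFamily.lean`; cert arithmetic in
`HOME/rb/certs/LOOP-ACTION-NORMBALL-rbp1.md`.
-/

noncomputable section

open MeasureTheory Function Real
open Literature.Probability.LatticeModels
open Literature.MathematicalPhysics.QuantumLattice
open Literature.MathematicalPhysics.QuantumFieldTheory (walkEdges)

namespace Summit.Ventures.YMGap.RobustBall

/-! ### All closed trails of `ℤ³` -/

/-- **`SU(2)`, `d = 3`, `β_W = 1/16` — all closed trails of `ℤ³`**: `‖c‖_{log 2} ≤ 0.219` ⇒ unique DLR state and exponential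
clustering (cell `su2_dim3_massGapOnLoopBall_1_16`). -/
theorem su2_dim3_allTrails_massGapS_1_16 {c : TrailIdx 3 → ℝ} (h : LoopNormLE (Real.log 2) trailLoop c (219 / 1000)) :
    PerturbedMassGapAtS 3 2 ((1 / 16 : ℝ) / 4) (loopFamilyAction (d := 3) 2 trailLoop c) :=
  su2_dim3_massGapOnLoopBall_1_16 _ _ _ finite_fibre_trailLoop h

/-- **`SU(2)`, `d = 3`, `β_W = 1/8` — all closed trails of `ℤ³`** at the slower weight `(3/2)^{dist}`: `‖c‖_{log (3/2)} ≤ 0.097`. -/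
theorem su2_dim3_allTrails_massGapS32_1_8 {c : TrailIdx 3 → ℝ} (h : LoopNormLE (Real.log (3 / 2)) trailLoop c (97 / 1000)) :
    PerturbedMassGapAtS 3 2 ((1 / 8 : ℝ) / 4) (loopFamilyAction (d := 3) 2 trailLoop c) :=
  su2_dim3_massGapOnLoopBall32_1_8 _ _ _ finite_fibre_trailLoop h

/-- **Every `N ≥ 2`, `d = 3`, 't Hooft `|β| ≤ 1/64` — all closed trails of `ℤ³`**: `‖c‖_{log (6/5)} ≤ 0.19`, `N`-uniformly and
uniformly in the window. -/
theorem suN_dim3_allTrails_massGapS_1_64 {N : ℕ} (hN : 2 ≤ N) {β : ℝ} (hβ : |β| ≤ 1 / 64) {c : TrailIdx 3 → ℝ}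
    (h : LoopNormLE (Real.log (6 / 5)) trailLoop c (19 / 100)) :
    PerturbedMassGapAtS 3 N β (loopFamilyAction (d := 3) N trailLoop c) :=
  suN_dim3_massGapOnLoopBall_1_64 hN hβ _ _ _ finite_fibre_trailLoop h

/-! ### All rectangles of `ℤ³` (three coordinate planes) -/

/-- **`SU(2)`, `d = 3`, `β_W = 1/16` — all rectangles of `ℤ³`, hypothesis-free**: `|c_{x,ab,R,T}| ≤ ½ · 32^{-(R+T)}` ⇒ unique DLR
state and exponential clustering (norm `≤ 3 · ½ · (1/3)² = 1/6 ≤ 0.219`). -/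
theorem su2_dim3_rectFamily_massGapS_1_16 {c : RectIdx 3 → ℝ} (hc : ∀ i, |c i| ≤ 1 / 2 * (1 / 32 : ℝ) ^ (i.2.1 + i.2.2 + 2)) :
    PerturbedMassGapAtS 3 2 ((1 / 16 : ℝ) / 4) (loopFamilyAction (d := 3) 2 rectLoop c) := by
  have hq : exp (Real.log 2) = 2 := Real.exp_log (by norm_num)
  have h := loopNormLE_rectLoop (d := 3) (w := Real.log 2) (ρ := 1 / 32) (τ := 1 / 2) (c := c)
    (Real.log_nonneg (by norm_num)) (by norm_num) (by norm_num) (by rw [hq]; norm_num) hc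
  have hP : Fintype.card {p : Fin 3 × Fin 3 // p.1 < p.2} = 3 := by decide
  rw [hq, hP] at h
  exact su2_dim3_massGapOnLoopBall_1_16 _ _ _ finite_fibre_rectLoop (h.mono (by norm_num))

/-- **Every `N ≥ 2`, `d = 3`, 't Hooft `|β| ≤ 1/64` — all rectangles of `ℤ³`, hypothesis-free**: `|c_i| ≤ 32^{-(R+T)}` suffices
(norm `≤ 3 · (s/(1−s))²`, `s = 3/20`, `= 0.0935 ≤ 0.19`). -/
theorem suN_dim3_rectFamily_massGapS_1_64 {N : ℕ} (hN : 2 ≤ N) {β : ℝ} (hβ : |β| ≤ 1 / 64) {c : RectIdx 3 → ℝ}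
    (hc : ∀ i, |c i| ≤ (1 / 32 : ℝ) ^ (i.2.1 + i.2.2 + 2)) :
    PerturbedMassGapAtS 3 N β (loopFamilyAction (d := 3) N rectLoop c) := by
  have hq : exp (Real.log (6 / 5)) = 6 / 5 := Real.exp_log (by norm_num)
  have h := loopNormLE_rectLoop (d := 3) (w := Real.log (6 / 5)) (ρ := 1 / 32) (τ := 1) (c := c)
    (Real.log_nonneg (by norm_num)) (by norm_num) (by norm_num) (by rw [hq]; norm_num)
    (fun i => by rw [one_mul]; exact hc i)
  have hP : Fintype.card {p : Fin 3 × Fin 3 // p.1 < p.2} = 3 := by decide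
  rw [hq, hP] at h
  exact suN_dim3_massGapOnLoopBall_1_64 hN hβ _ _ _ finite_fibre_rectLoop (h.mono (by norm_num))

end Summit.Ventures.YMGap.RobustBall

end
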